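import Mathlib
import Summits.MatrixMultiplication.MatrixMultiplication.Theorems.SnSubsetDichotomyNoThresholdSubsetTriplePlancherelStepDefs

/-!
# Definitions: the prefix shapes `shapeBefore` of a growth sequence (route `SnSubsetDichotomy`, crux `NoThresholdSubsetTriple`)

Line `klr-graded-polynomial-method`, crux `SnSubsetDichotomy.NoThresholdSubsetTriple` (stmt-MatrixMultiplication-8302), lead c7;
statement first recorded in the crux workfile `Lines/klr_dev_rungs2.lean`.  For a growth sequence `f : Fin n → ℕ × ℕ` (`f j` = the
cell of the entry `j` of a tableau), `PlancherelStep.shapeBefore f t` is the set of the cells of the entries `< t` — the shape reached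
after `t` steps of the growth (compare `Literature.RepresentationTheory.FiniteGroups.prefixCells f k`, the entries `≤ k`).  Like the
other `PlancherelStep` objects it is a `Finset (ℕ × ℕ)`, because the growth process INSERTS cells.

* `PlancherelStep.shapeBefore f t` — the cells `f j`, `j < t`;
* `shapeBefore_api` — for a standard Young tableau `T` of shape `Y` filling all `|Y| = n` cells: `shapeBefore T.1 0 = ∅`, the growth
  step `shapeBefore T.1 (t+1) = insert (T.1 t) (shapeBefore T.1 t)` (`t < n`), `|shapeBefore T.1 t| = t` (`t ≤ n`), every
  `shapeBefore T.1 t` is a lower set (a Young diagram), and the cell `T.1 t` of the entry `t` is an addable node of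
  `shapeBefore T.1 t` — i.e. `t ↦ shapeBefore T.1 t` is a saturated chain in Young's lattice from `∅` to `Y` (the MODEL theorem's
  dictionary between standard Young tableaux and growths).
-/

open scoped BigOperators
open Literature.RepresentationTheory.FiniteGroups (addableNodes IsAddableNode mem_addableNodes)
open Literature.NumberTheory.DiophantineGeometry (StdFilling)

-- `Summit.<Summit>.<Problem>`: the two coincide for this single-conjunct summit.
set_option linter.dupNamespace false

namespace Summit.MatrixMultiplication.MatrixMultiplication.Theorems

namespace PlancherelStep

/-- The shape of the entries `< t` of a growth sequence `f : Fin n → ℕ × ℕ` (so `shapeBefore f 0 = ∅` and, for a standard Young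
tableau filling all cells, `shapeBefore f (t+1) = insert (f t) (shapeBefore f t)`; compare `prefixCells f k` = entries `≤ k`). [folklore] -/
def shapeBefore {n : ℕ} (f : Fin n → ℕ × ℕ) (t : ℕ) : Finset (ℕ × ℕ) :=
  (Finset.univ.filter fun j : Fin n => j.1 < t).image f

end PlancherelStep

open PlancherelStep

/-- Membership in `shapeBefore f t`: the cells `f j` with `j < t` (unfolding lemma). [folklore] -/
private theorem mem_shapeBefore {n : ℕ} {f : Fin n → ℕ × ℕ} {t : ℕ} {x : ℕ × ℕ} :
    x ∈ shapeBefore f t ↔ ∃ j : Fin n, j.1 < t ∧ f j = x := by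
  simp [shapeBefore]

/-- No entry is `< 0`: the growth starts at the empty shape. [folklore] -/
private theorem shapeBefore_zero {n : ℕ} (f : Fin n → ℕ × ℕ) : shapeBefore f 0 = ∅ := by
  ext x
  simp [mem_shapeBefore]

/-- The growth step: the entries `< t + 1` are the entry `t` and the entries `< t`. [folklore] -/
private theorem shapeBefore_succ {n : ℕ} (f : Fin n → ℕ × ℕ) {t : ℕ} (ht : t < n) :
    shapeBefore f (t + 1) = insert (f ⟨t, ht⟩) (shapeBefore f t) := by
  have h : (Finset.univ.filter fun j : Fin n => j.1 < t + 1) =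
      insert ⟨t, ht⟩ (Finset.univ.filter fun j : Fin n => j.1 < t) := by
    ext j
    simp only [Finset.mem_filter, Finset.mem_univ, true_and, Finset.mem_insert, Fin.ext_iff]
    omega
  rw [shapeBefore, h, Finset.image_insert, shapeBefore]

/-- By injectivity, the cell of the entry `t` is not a cell of an entry `< t`. [folklore] -/
private theorem notMem_shapeBefore {n : ℕ} {f : Fin n → ℕ × ℕ} (hf : Function.Injective f) {t : ℕ}
    (ht : t < n) : f ⟨t, ht⟩ ∉ shapeBefore f t := by
  rw [mem_shapeBefore]
  rintro ⟨j, hj, hjt⟩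
  obtain rfl : j = ⟨t, ht⟩ := hf hjt
  exact lt_irrefl _ hj

/-- `|shapeBefore T.1 t| = t` for `t ≤ n`: each growth step of an injective filling adds one new cell. [folklore] -/
private theorem card_shapeBefore {n : ℕ} {Y : YoungDiagram} (T : StdFilling n Y) {t : ℕ} (ht : t ≤ n) :
    (shapeBefore T.1 t).card = t := by
  induction t with
  | zero => rw [shapeBefore_zero, Finset.card_empty]
  | succ t ih =>
    rw [shapeBefore_succ T.1 (Nat.lt_of_succ_le ht),
      Finset.card_insert_of_notMem (notMem_shapeBefore T.injective (Nat.lt_of_succ_le ht)),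
      ih (Nat.le_of_succ_le ht)]

/-- Every prefix shape of a standard Young tableau filling all cells of `Y` is a lower set: a cell weakly north-west
of the cell of an entry `j < t` is a cell of `Y` (Young diagrams are lower sets), hence carries an entry (all cells are
filled), which is `≤ j` by standardness. [folklore] -/
private theorem isLowerSet_shapeBefore {n : ℕ} {Y : YoungDiagram} (T : StdFilling n Y) (hY : Y.cells.card = n)
    (t : ℕ) : IsLowerSet ((shapeBefore T.1 t : Finset (ℕ × ℕ)) : Set (ℕ × ℕ)) := by
  intro x y hyx hx
  rw [Finset.mem_coe, mem_shapeBefore] at hx ⊢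
  obtain ⟨j, hj, rfl⟩ := hx
  have hy : y ∈ Y := Y.isLowerSet hyx (T.mem j)
  obtain ⟨j', hj'⟩ := T.exists_eq hY hy
  refine ⟨j', ?_, hj'⟩
  by_contra hlt
  have hjj' : j < j' := Fin.lt_def.2 (by omega)
  exact T.not_le hjj' (by rw [hj']; exact hyx)

/-- A cell weakly north-west of, and different from, the cell of the entry `t` of a standard Young tableau filling all
cells carries an entry `< t` (it carries some entry, not `t`, and not a larger one by standardness). [folklore] -/
private theorem mem_shapeBefore_of_le {n : ℕ} {Y : YoungDiagram} (T : StdFilling n Y) (hY : Y.cells.card = n)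
    {t : ℕ} (ht : t < n) {y : ℕ × ℕ} (hle : y ≤ T.1 ⟨t, ht⟩) (hne : y ≠ T.1 ⟨t, ht⟩) :
    y ∈ shapeBefore T.1 t := by
  have hy : y ∈ Y := Y.isLowerSet hle (T.mem _)
  obtain ⟨j', hj'⟩ := T.exists_eq hY hy
  rw [mem_shapeBefore]
  refine ⟨j', ?_, hj'⟩
  by_contra hlt
  rcases eq_or_lt_of_le (not_lt.1 hlt) with h | h
  · exact hne (hj'.symm.trans (congrArg T.1 (Fin.ext h.symm)))
  · exact T.not_le (show (⟨t, ht⟩ : Fin n) < j' from h) (by rw [hj']; exact hle)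

/-- The cell of the entry `t` is an addable node of the shape of the entries `< t`: it is a new cell (injectivity),
supported from above and from the left (the two neighbouring cells are weakly north-west of it, hence carry smaller
entries). [folklore] -/
private theorem mem_addableNodes_shapeBefore {n : ℕ} {Y : YoungDiagram} (T : StdFilling n Y)
    (hY : Y.cells.card = n) {t : ℕ} (ht : t < n) : T.1 ⟨t, ht⟩ ∈ addableNodes (shapeBefore T.1 t) := by
  rw [mem_addableNodes]
  refine ⟨notMem_shapeBefore T.injective ht, ?_, ?_⟩
  · rcases Nat.eq_zero_or_pos (T.1 ⟨t, ht⟩).1 with h | h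
    · exact Or.inl h
    · refine Or.inr (mem_shapeBefore_of_le T hY ht (Prod.le_def.2 ⟨Nat.sub_le _ _, le_rfl⟩) fun heq => ?_)
      have h' := congrArg Prod.fst heq
      dsimp only at h'
      omega
  · rcases Nat.eq_zero_or_pos (T.1 ⟨t, ht⟩).2 with h | h
    · exact Or.inl h
    · refine Or.inr (mem_shapeBefore_of_le T hY ht (Prod.le_def.2 ⟨le_rfl, Nat.sub_le _ _⟩) fun heq => ?_)
      have h' := congrArg Prod.snd heq
      dsimp only at h'
      omega

/-- **The prefix shapes of a standard Young tableau form a saturated chain in Young's lattice** (stub `shapeBefore_api`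
of line `klr-graded-polynomial-method`, crux `SnSubsetDichotomy.NoThresholdSubsetTriple`; the MODEL theorem's dictionary
between tableaux and growths).  For a standard Young tableau `T` of shape `Y` filling all `|Y| = n` cells:
`shapeBefore T.1 0 = ∅`; `shapeBefore T.1 (t+1) = insert (T.1 t) (shapeBefore T.1 t)` for `t < n`;
`|shapeBefore T.1 t| = t` for `t ≤ n`; every `shapeBefore T.1 t` is a lower set; and the cell `T.1 t` of the entry `t`
is an addable node of `shapeBefore T.1 t`. [folklore] -/
theorem shapeBefore_api : ∀ (n : ℕ) (Y : YoungDiagram) (T : StdFilling n Y), Y.cells.card = n →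
    shapeBefore T.1 0 = ∅ ∧
    (∀ (t : ℕ) (ht : t < n), shapeBefore T.1 (t + 1) = insert (T.1 ⟨t, ht⟩) (shapeBefore T.1 t)) ∧
    (∀ t : ℕ, t ≤ n → (shapeBefore T.1 t).card = t) ∧
    (∀ t : ℕ, IsLowerSet ((shapeBefore T.1 t : Finset (ℕ × ℕ)) : Set (ℕ × ℕ))) ∧
    (∀ (t : ℕ) (ht : t < n), T.1 ⟨t, ht⟩ ∈ addableNodes (shapeBefore T.1 t)) := by
  intro n Y T hY
  exact ⟨shapeBefore_zero T.1, fun t ht => shapeBefore_succ T.1 ht, fun t ht => card_shapeBefore T ht,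
    isLowerSet_shapeBefore T hY, fun t ht => mem_addableNodes_shapeBefore T hY ht⟩

end Summit.MatrixMultiplication.MatrixMultiplication.Theorems
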